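import Mathlib.RingTheory.Ideal.MinimalPrime.Noetherian
import Mathlib.RingTheory.Noetherian.Basic
import Mathlib.Data.Nat.Prime.Basic
import HarnessLib

/-!
# Large residue characteristic by Noetherian induction ("for `p ≫ 0` depending on the degrees")

Topic: `Literature/AlgebraicGeometry/Resolution`. A brick for passing from characteristic zero
to large positive characteristic in statements quantified over inputs of bounded complexity —
here: for the named fact `BierstoneGrigorievMilmanWlodarczyk2011_marked`
(`EffectiveResolutionMarked.lean`; Bierstone–Grigoriev–Milman–Włodarczyk 2011, Cor. 8.0.6:
resolution of the marked ideal `(𝔸ⁿ_k, (S), ∅, 1)`, `|S| ≤ l`, degrees `≤ d`, in characteristic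
`p > M(d, n, l)`), whose planned proof is: resolution in characteristic ZERO at the generic points
of the space `Spec ℤ[coefficients]` of all inputs, SPREADING OUT over an open neighbourhood of
each such generic point, and the NOETHERIAN INDUCTION below, which converts "good on a
neighbourhood of every point of residue characteristic zero" into "good at every point of
residue characteristic `0` or `> M`" for some bound `M` (non-explicit, unlike BGMW's
`M(d, n, l) ∈ 𝓔^{n+3}`).

PROVED here, for the prime ideals of a Noetherian ring `R` (the points of `Spec R`): let `Good`
be a property of ideals such that every prime `𝔮` containing no prime NUMBER (residue
characteristic zero) admits `f ∉ 𝔮` with `Good 𝔭` for all primes `𝔭 ⊇ 𝔮` not containing `f`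
(i.e. on the open `D(f) ∩ V(𝔮)` of the irreducible closed set `V(𝔮)`). Then there is `M : ℕ`
such that `Good 𝔭` holds for every prime `𝔭` all of whose prime numbers are `> M` — every
prime of residue characteristic `0` or `> M` (`exists_bound_forall_prime_of_generic`). Proof:
Noetherian induction on `I` for the primes above `I`; the finitely many minimal primes `𝔮` of
`I` either contain a prime number `p_𝔮` (then all primes above them do) or have characteristic
zero, where the hypothesis and the induction hypothesis for `𝔮 + (f_𝔮) > I` apply.

## Sources

* folklore (Noetherian induction / "spreading out", cf. EGA IV₃ §8, §9); the application:
  E. Bierstone, D. Grigoriev, P. Milman, J. Włodarczyk, arXiv:1206.3090, Cor. 8.0.6.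
  [BierstoneGrigorievMilmanWlodarczyk2011]
-/

namespace Literature.AlgebraicGeometry.Resolution

universe u

variable {R : Type u} [CommRing R]

/-- A bound that works for the primes above `𝔮` keeps working when enlarged. [folklore] -/
theorem bound_mono {Good : Ideal R → Prop} {𝔮 : Ideal R} {M M' : ℕ} (hMM' : M ≤ M')
    (hM : ∀ 𝔭 : Ideal R, 𝔭.IsPrime → 𝔮 ≤ 𝔭 → (∀ p : ℕ, p.Prime → (p : R) ∈ 𝔭 → M < p) → Good 𝔭)
    (𝔭 : Ideal R) (h𝔭 : 𝔭.IsPrime) (hle : 𝔮 ≤ 𝔭) (hp : ∀ p : ℕ, p.Prime → (p : R) ∈ 𝔭 → M' < p) :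
    Good 𝔭 :=
  hM 𝔭 h𝔭 hle fun p hp' hpm => lt_of_le_of_lt hMM' (hp p hp' hpm)

variable [IsNoetherianRing R]

/-- **Large residue characteristic by Noetherian induction.** Let `R` be a Noetherian ring and
`Good` a property of its ideals. Suppose that for every prime `𝔮` of residue characteristic zero
(no prime number lies in `𝔮`) there is `f ∉ 𝔮` such that every prime `𝔭 ⊇ 𝔮` with `f ∉ 𝔭` is
good ("good on a non-empty open subset of `V(𝔮)`"). Then there is a bound `M` such that every
prime `𝔭` of residue characteristic `0` or `> M` (every prime number lying in `𝔭` exceeds `M`)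
is good. [folklore] -/
theorem exists_bound_forall_prime_of_generic (Good : Ideal R → Prop)
    (h : ∀ 𝔮 : Ideal R, 𝔮.IsPrime → (∀ p : ℕ, p.Prime → (p : R) ∉ 𝔮) →
      ∃ f ∉ 𝔮, ∀ 𝔭 : Ideal R, 𝔭.IsPrime → 𝔮 ≤ 𝔭 → f ∉ 𝔭 → Good 𝔭) :
    ∃ M : ℕ, ∀ 𝔭 : Ideal R, 𝔭.IsPrime → (∀ p : ℕ, p.Prime → (p : R) ∈ 𝔭 → M < p) → Good 𝔭 := by
  classical
  -- Noetherian induction: a bound for the primes above `I`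
  suffices key : ∀ I : Ideal R, ∃ M : ℕ, ∀ 𝔭 : Ideal R, 𝔭.IsPrime → I ≤ 𝔭 →
      (∀ p : ℕ, p.Prime → (p : R) ∈ 𝔭 → M < p) → Good 𝔭 by
    obtain ⟨M, hM⟩ := key ⊥
    exact ⟨M, fun 𝔭 h𝔭 hp => hM 𝔭 h𝔭 bot_le hp⟩
  intro I
  induction I using IsNoetherian.induction with
  | hgt I ih =>
    -- a bound above each minimal prime of `I`
    have hmin : ∀ 𝔮 ∈ Ideal.minimalPrimes I, ∃ M : ℕ, ∀ 𝔭 : Ideal R, 𝔭.IsPrime → 𝔮 ≤ 𝔭 →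
        (∀ p : ℕ, p.Prime → (p : R) ∈ 𝔭 → M < p) → Good 𝔭 := by
      intro 𝔮 h𝔮
      have h𝔮p : 𝔮.IsPrime := h𝔮.1.1
      have hI𝔮 : I ≤ 𝔮 := h𝔮.1.2
      by_cases hchar : ∃ p : ℕ, p.Prime ∧ (p : R) ∈ 𝔮
      · -- positive residue characteristic `p`: every prime above `𝔮` contains `p`
        obtain ⟨p, hp, hp𝔮⟩ := hchar
        exact ⟨p, fun 𝔭 _ hle hbd => absurd (hbd p hp (hle hp𝔮)) (lt_irrefl p)⟩
      · -- residue characteristic zero: good on `D(f) ∩ V(𝔮)`, induction on `V(𝔮 + (f))`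
        push Not at hchar
        obtain ⟨f, hf𝔮, hf⟩ := h 𝔮 h𝔮p fun p hp => hchar p hp
        have hlt : I < 𝔮 ⊔ Ideal.span {f} := by
          refine lt_of_le_of_ne (hI𝔮.trans le_sup_left) fun heq => hf𝔮 (hI𝔮 ?_)
          rw [heq]
          exact Ideal.mem_sup_right (Ideal.mem_span_singleton_self f)
        obtain ⟨M, hM⟩ := ih _ hlt
        refine ⟨M, fun 𝔭 h𝔭 hle hbd => ?_⟩
        by_cases hf𝔭 : f ∈ 𝔭
        · exact hM 𝔭 h𝔭 (sup_le hle ((Ideal.span_singleton_le_iff_mem _).mpr hf𝔭)) hbd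
        · exact hf 𝔭 h𝔭 hle hf𝔭
    choose! Mf hMf using hmin
    -- the maximum over the finitely many minimal primes
    refine ⟨(Ideal.finite_minimalPrimes_of_isNoetherianRing R I).toFinset.sup Mf, fun 𝔭 h𝔭 hI𝔭 hbd => ?_⟩
    obtain ⟨𝔮, h𝔮, h𝔮𝔭⟩ := Ideal.exists_minimalPrimes_le hI𝔭
    refine bound_mono (Finset.le_sup (f := Mf) ?_) (hMf 𝔮 h𝔮) 𝔭 h𝔭 h𝔮𝔭 hbd
    exact (Set.Finite.mem_toFinset _).mpr h𝔮

end Literature.AlgebraicGeometry.Resolution
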